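import Summits.HubbardSuperconductivity.HubbardSuperconductivity.Theorems.KLProgrammeKLRegimeTwoPointAssemblyMatsubaraDetBound
import Summits.HubbardSuperconductivity.HubbardSuperconductivity.Theorems.KLProgrammeKLRegimeTwoPointAssemblyMatsubaraClusterIntegralCube
import Summits.HubbardSuperconductivity.HubbardSuperconductivity.Theorems.KLProgrammeKLRegimeTwoPointAssemblyMatsubaraRemainderKernel
import Literature.MathematicalPhysics.QuantumLattice.HubbardPartitionFunctionMatsubaraLimit
import HarnessLib

/-!
# Route `KLProgramme`, crux K3, child 4 `KLRegimeTwoPointAssembly`, stub `stub_asm_matsubara` —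
# part F: the PARTITION-FUNCTION BRIDGE FOR EVERY COUPLING (`Grassmann(L, M → ∞) = trace` without the tree radius)

Cell gate-hubbard-kl, seat t2 (HOME/t2/MATSUBARA-ALLU-SCOPE.md §2 (g)).  The tree's bridge
`tendsto_effPartitionFn_hubbard_eq_partitionFn_div` carries the smallness `2e|U|L²βB² < 1` because its Tannery domination is
Hadamard's `(n!)⁻¹(|U|L²β(2n)B²)ⁿ`.  Parts A–E replace it by an `n!`-free-up-to-geometric domination valid for EVERY `U` at
fixed `(L, β)`:

* `card_filter_fst_le_two` — an injective leg enumeration puts at most two legs on a point;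
* **`norm_gaussExpect_hubbardInteraction_pow_le_allU`** — there are `K₀ ≥ 0` and `ε_M → 0` with, for all `M, n` and every
  `r > 0`:  `‖∫dμ_{C_M} Vⁿ‖ ≤ n! · e^{βr} e^{(βK₀ + nε_M) r e^{βK₀r}} · (64|U|L²/r)ⁿ`;
* **`tendsto_effPartitionFn_hubbard_zero_seed_allU`** — for `β > 0` and EVERY real `U`, `∫dμ_{C_M}e^{−V}` converges to the
  determinant series (Tannery with `r = 128|U|L² + 1` and `M` large: ratio `≤ ¾`);
* **`tendsto_effPartitionFn_hubbard_eq_partitionFn_div_allU`** — THE BRIDGE for all `U`: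
  `∫dμ_{C_M} e^{−V_M(U)} ⟶ e^{−βUL²/4} Z_L(β; U, μ+U/2)/Z_L(β; 0, μ)` (`L ≥ 3`, `β > 0`), by `hasSum_vertexLimitDet_series`.
-/

namespace Summit.HubbardSuperconductivity.HubbardSuperconductivity.Theorems.MatsubaraAllU

set_option linter.dupNamespace false -- summit = problem name (single-conjunct summit), D-0017

open MeasureTheory Finset Filter Topology Literature.MathematicalPhysics.QuantumLattice
  Literature.Probability.LatticeModels
open Literature.MathematicalPhysics.QuantumLattice.GrassmannAlgebra
open scoped Nat

noncomputable section

/-- An injective leg enumeration `P : Fin N → Fin m × Fin 2` puts at most two legs on each point. -/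
theorem card_filter_fst_le_two {N m : ℕ} (P : Fin N → Fin m × Fin 2) (hP : Function.Injective P) (a : Fin m) :
    (univ.filter fun i => (P i).1 = a).card ≤ 2 := by
  classical
  have h := Finset.card_le_card_of_injOn (fun i => (P i).2) (s := univ.filter fun i => (P i).1 = a)
    (t := (univ : Finset (Fin 2))) (fun i _ => mem_univ _) (fun i hi i' hi' h2 => by
      have h1 : (P i).1 = (P i').1 := by
        rw [(mem_filter.mp (Finset.mem_coe.mp hi)).2, (mem_filter.mp (Finset.mem_coe.mp hi')).2]
      exact hP (Prod.ext h1 h2))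
  simpa using h

variable {L : ℕ} [NeZero L]

/-- **M-uniform domination of the interaction moments for every coupling.**  For `β > 0` there are `K₀ ≥ 0` and
`ε_M ≥ 0`, `ε_M → 0`, such that for all `M, n` and every `r > 0`:
`‖∫dμ_{C_M} Vⁿ‖ ≤ n! · (e^{βr} · exp((βK₀ + nε_M) r e^{βK₀ r})) · (64|U|L²/r)ⁿ`.
(Parts C–E pointwise, part B integrated; the vertex sum contributes `L^{2n}`, the `2n` legs `4^{2n}·4ⁿ`.) -/
theorem norm_gaussExpect_hubbardInteraction_pow_le_allU {β : ℝ} (hβ : 0 < β) (μ U : ℝ) :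
    ∃ (K₀ : ℝ) (ε : ℕ → ℝ), 0 ≤ K₀ ∧ (∀ M, 0 ≤ ε M) ∧ Tendsto ε atTop (𝓝 0) ∧
      ∀ (M n : ℕ) (r : ℝ), 0 < r →
        ‖gaussExpect ℂ (hubbardCovariance L M β μ 0) (hubbardInteraction L M β U ^ n)‖ ≤
          (n ! : ℝ) * (Real.exp (β * r) * Real.exp ((β * K₀ + n * ε M) * r * Real.exp (β * K₀ * r))) *
            (64 * |U| * (L : ℝ) ^ 2 / r) ^ n := by
  classical
  obtain ⟨K₀, wr, hK₀, hwm, hw0, hwK, hwI, hshift, hlim, hkey⟩ := exists_remainderKernel L hβ μ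
  refine ⟨K₀, fun M => ∫ u, wr M u, hK₀, fun M => integral_nonneg fun u => hw0 M u, hlim, ?_⟩
  intro M n r hr
  have hcard : ((Fintype.card (Fin n → TorusSite 2 L) : ℕ) : ℝ) = ((L : ℝ) ^ 2) ^ n := by
    rw [Fintype.card_fun, Fintype.card_fin, Nat.cast_pow, Fintype.card_pi, prod_const, ZMod.card, card_univ,
      Fintype.card_fin, Nat.cast_pow]
  have hfib : ∀ a : Fin n, (univ.filter fun i : Fin (n * 2) => ((finProdFinEquiv.symm i : Fin n × Fin 2)).1 = a).card ≤ 2 :=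
    card_filter_fst_le_two _ finProdFinEquiv.symm.injective
  -- the cluster integral bound at this `M`
  have hI := integral_sum_prod_sum_le (m := n) β hβ.le (wr M) (hwm M) (hw0 M) K₀ (∫ u, wr M u) hK₀
    (integral_nonneg fun u => hw0 M u) (hwK M) (hshift M) r hr
  -- each vertex configuration
  have hdet : ∀ xv : Fin n → TorusSite 2 L, ‖∫ τ in Set.Icc (0 : Fin n → ℝ) (fun _ => β),
      (Matrix.of fun i j : Fin (n * 2) => -((vertexSubMatrix L M β xv τ).transpose * hubbardCovariance L M β μ 0 *
        vertexSubMatrix L M β xv τ) ((((finProdFinEquiv.symm i : Fin n × Fin 2)), 0) : VertexLeg n)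
          ((((finProdFinEquiv.symm j : Fin n × Fin 2)), 1) : VertexLeg n)).det‖ ≤
      (4 : ℝ) ^ (n * 2) * 4 ^ n * ((n ! : ℝ) / r ^ n * Real.exp (β * r) *
        Real.exp ((β * K₀ + n * ∫ u, wr M u) * r * Real.exp (β * K₀ * r))) := by
    intro xv
    refine (norm_integral_le_of_norm_le (((integrableOn_sum_prod_sum β (wr M) (hwm M) (hw0 M) K₀ (hwK M)).const_mul
      ((4 : ℝ) ^ (n * 2) * 4 ^ n))) ?_).trans ?_
    · refine (ae_restrict_iff' measurableSet_Icc).2 (ae_of_all _ fun τ hτ => ?_)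
      exact norm_det_vertexWick_le_sum_prod hβ μ xv τ (fun a => ⟨hτ.1 a, hτ.2 a⟩) _ _ hfib hfib (wr M) (hw0 M)
        (hkey M)
    · rw [integral_const_mul]
      exact mul_le_mul_of_nonneg_left hI (by positivity)
  have h64 : (4 : ℝ) ^ (n * 2) * 4 ^ n = 64 ^ n := by
    rw [mul_comm n 2, pow_mul, ← mul_pow]
    norm_num
  rw [gaussExpect_hubbardInteraction_pow_eq_det hβ, norm_mul, norm_pow, Complex.norm_real, Real.norm_eq_abs]
  calc |U| ^ n * ‖∑ xv : Fin n → TorusSite 2 L, _‖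
      ≤ |U| ^ n * ∑ xv : Fin n → TorusSite 2 L, (4 : ℝ) ^ (n * 2) * 4 ^ n * ((n ! : ℝ) / r ^ n * Real.exp (β * r) *
          Real.exp ((β * K₀ + n * ∫ u, wr M u) * r * Real.exp (β * K₀ * r))) := by
        gcongr
        exact (norm_sum_le _ _).trans (sum_le_sum fun xv _ => hdet xv)
    _ = (n ! : ℝ) * (Real.exp (β * r) * Real.exp ((β * K₀ + n * ∫ u, wr M u) * r * Real.exp (β * K₀ * r))) *
          (64 * |U| * (L : ℝ) ^ 2 / r) ^ n := by
        rw [sum_const, card_univ, nsmul_eq_mul, hcard, h64, div_pow]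
        have hr' : r ^ n ≠ 0 := pow_ne_zero _ hr.ne'
        field_simp
        ring

/-- **The `M → ∞` limit of the normalised Grassmann partition function for EVERY coupling** (zero seed): for `β > 0` and
every real `U`, `∫dμ_{C_M} e^{−V} ⟶ Σ'_n ((−1)ⁿ/n!) Uⁿ Σ_{x⃗} ∫_{[0,β]ⁿ} det[vertexLimitEntry …]` — the tree's
`tendsto_effPartitionFn_hubbard_zero_seed` WITHOUT `2e|U|L²βB² < 1`.  Tannery: with `r = 128|U|L² + 1` and `M` so large that
`ε_M r e^{βK₀r} ≤ ¼`, the `n`-th term is dominated by `D·(¾)ⁿ` uniformly in `M`. -/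
theorem tendsto_effPartitionFn_hubbard_zero_seed_allU {β : ℝ} (hβ : 0 < β) (μ U : ℝ) :
    Tendsto (fun M : ℕ => effPartitionFn ℂ (hubbardCovariance L M β μ 0) (hubbardInteraction L M β U)) atTop
      (𝓝 (∑' n : ℕ, ((-1 : ℂ) ^ n * ((n ! : ℂ))⁻¹) * ((U : ℂ) ^ n * ∑ x : Fin n → TorusSite 2 L,
        ∫ τ in Set.Icc (0 : Fin n → ℝ) (fun _ => β),
          (Matrix.of fun i j : Fin (n * 2) =>
            vertexLimitEntry L β μ (x (finProdFinEquiv.symm i : Fin n × Fin 2).1)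
              (x (finProdFinEquiv.symm j : Fin n × Fin 2).1) (finProdFinEquiv.symm i : Fin n × Fin 2).2
              (finProdFinEquiv.symm j : Fin n × Fin 2).2
              (τ (finProdFinEquiv.symm j : Fin n × Fin 2).1 - τ (finProdFinEquiv.symm i : Fin n × Fin 2).1)).det))) := by
  obtain ⟨K₀, ε, hK₀, hε0, hεlim, hmom⟩ := norm_gaussExpect_hubbardInteraction_pow_le_allU (L := L) hβ μ U
  -- the radius parameter and the eventual smallness of the remainder mass
  set r : ℝ := 128 * |U| * (L : ℝ) ^ 2 + 1 with hr
  have hr0 : 0 < r := by positivity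
  have hratio : 64 * |U| * (L : ℝ) ^ 2 / r ≤ 1 / 2 := by
    rw [div_le_iff₀ hr0, hr]
    nlinarith [abs_nonneg U, sq_nonneg (L : ℝ)]
  have hratio0 : 0 ≤ 64 * |U| * (L : ℝ) ^ 2 / r := by positivity
  set A : ℝ := r * Real.exp (β * K₀ * r) with hA
  have hA0 : 0 < A := by positivity
  have hev : ∀ᶠ M in atTop, ε M * A ≤ 1 / 4 := by
    have h1 : Tendsto (fun M => ε M * A) atTop (𝓝 (0 * A)) := hεlim.mul_const A
    rw [zero_mul] at h1
    exact (h1.eventually (ge_mem_nhds (by norm_num : (0 : ℝ) < 1 / 4))).mono fun M hM => hM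
  set D : ℝ := Real.exp (β * r) * Real.exp (β * K₀ * A) with hD
  -- the finite-`M` partition functions as series
  have hZ : ∀ M : ℕ, effPartitionFn ℂ (hubbardCovariance L M β μ 0) (hubbardInteraction L M β U) =
      ∑' n : ℕ, ((-1 : ℂ) ^ n * ((n ! : ℂ))⁻¹) *
        gaussExpect ℂ (hubbardCovariance L M β μ 0) (hubbardInteraction L M β U ^ n) := fun M =>
    effPartitionFn_eq_tsum _ (constPart_hubbardInteraction L M β U)
  simp_rw [hZ]
  refine tendsto_tsum_of_dominated_convergence (bound := fun n => D * (3 / 4 : ℝ) ^ n) ?_ (fun n => ?_) ?_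
  · exact (summable_geometric_of_lt_one (by norm_num) (by norm_num)).mul_left D
  · exact (tendsto_gaussExpect_hubbardInteraction_pow hβ μ U n).const_mul _
  · filter_upwards [hev] with M hM n
    have hεA1 : |ε M * A| ≤ 1 := by
      rw [abs_of_nonneg (mul_nonneg (hε0 M) hA0.le)]; linarith
    have hexp : Real.exp (ε M * A) ≤ 3 / 2 := by
      have h := Real.abs_exp_sub_one_le hεA1
      rw [abs_of_nonneg (mul_nonneg (hε0 M) hA0.le)] at h
      have h' := (abs_le.mp h).2
      linarith
    rw [norm_mul, norm_mul, norm_pow, norm_neg, norm_one, one_pow, one_mul, norm_inv, Complex.norm_natCast]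
    have hfac : (0 : ℝ) < n ! := by exact_mod_cast Nat.factorial_pos n
    have hkey := hmom M n r hr0
    have hsplit : Real.exp ((β * K₀ + n * ε M) * r * Real.exp (β * K₀ * r)) =
        Real.exp (β * K₀ * A) * Real.exp (ε M * A) ^ n := by
      rw [← Real.exp_nat_mul, ← Real.exp_add, hA]
      ring_nf
    calc ((n ! : ℝ))⁻¹ * ‖gaussExpect ℂ (hubbardCovariance L M β μ 0) (hubbardInteraction L M β U ^ n)‖
        ≤ ((n ! : ℝ))⁻¹ * ((n ! : ℝ) * (Real.exp (β * r) *
            Real.exp ((β * K₀ + n * ε M) * r * Real.exp (β * K₀ * r))) * (64 * |U| * (L : ℝ) ^ 2 / r) ^ n) := by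
          gcongr
      _ = D * (Real.exp (ε M * A) * (64 * |U| * (L : ℝ) ^ 2 / r)) ^ n := by
          rw [hsplit, hD, mul_pow]
          field_simp
      _ ≤ D * (3 / 4 : ℝ) ^ n := by
          gcongr
          calc Real.exp (ε M * A) * (64 * |U| * (L : ℝ) ^ 2 / r) ≤ (3 / 2) * (1 / 2) :=
                mul_le_mul hexp hratio hratio0 (by norm_num)
            _ = 3 / 4 := by norm_num

/-- **THE BRIDGE FOR EVERY COUPLING: the Matsubara ultraviolet limit of the Grassmann partition function is the
Hamiltonian trace.**  For `L ≥ 3`, `β > 0` and EVERY real `U` (no smallness), as `M → ∞`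
`∫dμ_{C_M} e^{-V_M(U)} ⟶ e^{-βUL²/4} · Z_L(β; U, μ + U/2) / Z_L(β; 0, μ)`, `Z_L(β; U, μ) = Tr e^{-β hubbardTorusWith 2 L 1 U μ}`
— the tree's `tendsto_effPartitionFn_hubbard_eq_partitionFn_div` without its radius `2e|U|L²βB² < 1`. -/
theorem tendsto_effPartitionFn_hubbard_eq_partitionFn_div_allU (hL : 3 ≤ L) {β : ℝ} (hβ : 0 < β) (μ U : ℝ) :
    Tendsto (fun M : ℕ => effPartitionFn ℂ (hubbardCovariance L M β μ 0) (hubbardInteraction L M β U)) atTop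
      (𝓝 ((Real.exp (-(β * U / 4 * (L : ℝ) ^ 2)) : ℂ) * Matrix.partitionFn β (hubbardTorusWith 2 L 1 U (μ + U / 2)) /
        Matrix.partitionFn β (hubbardTorusWith 2 L 1 0 μ))) := by
  rw [← (hasSum_vertexLimitDet_series hL hβ μ U).tsum_eq]
  exact tendsto_effPartitionFn_hubbard_zero_seed_allU hβ μ U

end

end Summit.HubbardSuperconductivity.HubbardSuperconductivity.Theorems.MatsubaraAllU
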